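import Mathlib
import Literature.NumberTheory.LFunctions.Zhang2022.SkeletonPartOne
import Literature.NumberTheory.LFunctions.Zhang2022.SkeletonAssembly
import Literature.NumberTheory.LFunctions.Zhang2022.Section4PartialIntegration
import Literature.NumberTheory.LFunctions.Zhang2022.Section3SigmaSplitting
import HarnessLib

/-!
# Zhang (2022), §4 Lemma 4.2 DISCHARGED: `F(s,ψ)G(s,ψ) = 1 + O(𝓛⁻²²⁷)` on `Ω₁` for `ψ ∈ Ψ₁`
# (DAG node `Z22:Lem4.2`, proof node `Z22:Lem4.2.pf`; cone leaf `h42` of `theorem1_of_leaves`)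

Topic `Literature/NumberTheory/LFunctions/Zhang2022` (Landau–Siegel audit tree; verdict-neutral).
Y. Zhang, *Discrete mean estimates and the Landau–Siegel zero*, arXiv:2211.02515v1 (2022)
[Zhang2022LandauSiegel] — **an unrefereed manuscript under adjudication.** This file PROVES the
skeleton's CLAIM node `Skeleton.Lemma42` outright (no hypotheses): [Z22 p.17, Lemma 4.2, tex L925–L944]

> Lemma 4.2. If `s ∈ Ω₁`, then `F(s,ψ)G(s,ψ) = 1 + O(𝓛⁻²²⁷)`.
> Proof. We have `F(s,ψ)G(s,ψ) − 1 = Σ_{D⁴<n≤D⁸} ς(n)ψ(n)n^{−s} = ∫_{D⁴}^{D⁸} x^{s₀−s} d{X₄(x,ψ)}`.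
> Thus, similar to (4.2), by partial integration we obtain
> `F(s,ψ)G(s,ψ) − 1 ≪ 𝓛⁴⁰⁶(|X₄(D⁸,ψ)| + ∫_{D⁴}^{D⁸} |X₄(x,ψ)|x⁻¹dx)`,
> the right side being `O(𝓛⁻²²⁷)` by (3.6). □

(standing assumption of §4, tex L886: `ψ ∈ Ψ₁`, i.e. (3.4)–(3.6) hold for `ψ`). The three steps:

* `sum_mul_weight_mul_sum_mul_weight` — the finite Dirichlet-product identity behind
  "`F(s,ψ)G(s,ψ) − 1 = Σ ς(n)ψ(n)n^{−s}`": for coefficient sequences `a`, `b` supported on `n ≤ A`,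
  `n ≤ B` and a completely multiplicative weight `f` (here `f(n) = ψ(n)n^{−s}`),
  `(Σ_{n≤A} a(n)f(n))(Σ_{n≤B} b(n)f(n)) = Σ_{n≤AB} (a∗b)(n)f(n)` — stated for general supports so
  that the `20`-fold version behind Lemma 4.1 (`F²⁰ = Σ_{n≤D⁸⁰} ν₂₀ψn^{−s}`) follows by induction;
* `nu_convolution_ups` — `ν ∗ υ = δ` (`ν = ζ∗χ`, `υ = μ∗μχ`; the tree's `mul_pmul_moebius_eq_one`),
  whence `sig_eq_of_le` — "`ς(n) = 0` unless `n = 1` or `D⁴ < n ≤ D⁸`" (`ς(1) = 1`), and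
  `Fpoly_mul_Gpoly_sub_one` — the first display of the proof, EXACT;
* `lemma42_holds` — the partial integration is the tree's `Lemma41.norm_sum_Ioc_le`
  (`Section4PartialIntegration`: on `Ω₁`, `|Σ_{a<n≤b} c(n)n^{s₀−s}| ≤ 𝓛^{4/5}|X_a(b)| +
  𝓛⁴⁰⁶∫_a^b|X_a|dx/x` for `𝓛 ≥ 32`), with `c(n) = ς(n)ψ(n)n^{−s₀}`, `a = D⁴`, `b = D⁸`, so that
  `X_a = X₄(·,ψ)`; then (3.6) (`ψ ∈ Ψ₁`) gives `|FG − 1| ≤ 𝓛⁴⁰⁶·𝓛⁻⁶³³ = 𝓛⁻²²⁷` — implied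
  constant `C = 1`, threshold `D ≥ ⌈e³²⌉` (so that `𝓛 ≥ 32`, the tree's `norm_mul_le_rpow_406`).

What is NOT asserted: anything about Theorems 1–2 of the source or about Landau–Siegel zeros;
(3.6) is not proved here for any particular `ψ` — it is the DEFINITION of `ψ ∈ Ψ₁` (the size of
`Ψ₁` is Proposition 2.1, a separate node). Nothing here bears on the cell's verdict on (8.24).

## References

* Y. Zhang, arXiv:2211.02515v1 (2022), §4 p. 17, Lemma 4.2 and its proof; §3 p. 15 (`ς`, `X₄`,
  (3.6), `Ψ₁`); §4 Lemma 4.1 (`Ω₁`). [cite: Zhang2022LandauSiegel, §4 Lemma 4.2]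
-/

noncomputable section

open Complex Real Finset
open scoped LSeries.notation ArithmeticFunction.Moebius ArithmeticFunction.zeta

namespace Literature.NumberTheory.LFunctions.Zhang2022.Skeleton

/-! ## The finite Dirichlet-product identity -/

/-- **Product of two finite Dirichlet polynomials with a completely multiplicative weight**: if
`a` vanishes beyond `A` and `b` beyond `B`, and `f(mn) = f(m)f(n)`, then
`(Σ_{n≤A} a(n)f(n))·(Σ_{n≤B} b(n)f(n)) = Σ_{n≤AB} (a ∗ b)(n)f(n)` (`∗` = Dirichlet convolution,
Mathlib's `LSeries.convolution`). With `f(n) = ψ(n)n^{−s}` this is the algebra behind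
"`F(s,ψ)G(s,ψ) − 1 = Σ_{D⁴<n≤D⁸} ς(n)ψ(n)n^{−s}`" and "`F(s,ψ)²⁰ = Σ_{n≤D⁸⁰} ν₂₀(n)ψ(n)n^{−s}`".
[cite: Zhang2022LandauSiegel, §3 p. 15 (definition of ς); §4 Lemma 4.2 (proof)] -/
theorem sum_mul_weight_mul_sum_mul_weight (a b f : ℕ → ℂ) {A B : ℕ}
    (ha : ∀ n, A < n → a n = 0) (hb : ∀ n, B < n → b n = 0)
    (hf : ∀ m n, f (m * n) = f m * f n) :
    (∑ n ∈ Icc 1 A, a n * f n) * (∑ n ∈ Icc 1 B, b n * f n)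
      = ∑ n ∈ Icc 1 (A * B), (a ⍟ b) n * f n := by
  classical
  rw [Finset.sum_mul_sum, ← Finset.sum_product']
  -- regroup the pairs `(l, m)` by the value `n = lm ∈ [1, AB]`
  have hmaps : ∀ p ∈ Icc 1 A ×ˢ Icc 1 B, p.1 * p.2 ∈ Icc 1 (A * B) := by
    intro p hp
    simp only [Finset.mem_product, Finset.mem_Icc] at hp ⊢
    exact ⟨Nat.mul_pos hp.1.1 hp.2.1, Nat.mul_le_mul hp.1.2 hp.2.2⟩
  rw [← Finset.sum_fiberwise_of_maps_to hmaps]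
  refine Finset.sum_congr rfl fun n hn => ?_
  have hn0 : n ≠ 0 := by have := (Finset.mem_Icc.mp hn).1; omega
  rw [LSeries.convolution_def, Finset.sum_mul]
  -- the fibre over `n` inside `[1,A] × [1,B]` is the part of `n.divisorsAntidiagonal` there
  have hfib : (Icc 1 A ×ˢ Icc 1 B).filter (fun p => p.1 * p.2 = n)
      = n.divisorsAntidiagonal.filter (fun p => p.1 ≤ A ∧ p.2 ≤ B) := by
    ext p
    simp only [Finset.mem_filter, Finset.mem_product, Finset.mem_Icc,
      Nat.mem_divisorsAntidiagonal]
    constructor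
    · rintro ⟨⟨⟨-, h2⟩, ⟨-, h4⟩⟩, h5⟩
      exact ⟨⟨h5, hn0⟩, h2, h4⟩
    · rintro ⟨⟨h5, -⟩, h2, h4⟩
      have h1 : 0 < p.1 := Nat.pos_of_ne_zero fun h => hn0 (by rw [← h5, h, zero_mul])
      have h3 : 0 < p.2 := Nat.pos_of_ne_zero fun h => hn0 (by rw [← h5, h, mul_zero])
      exact ⟨⟨⟨h1, h2⟩, ⟨h3, h4⟩⟩, h5⟩
  rw [hfib, Finset.sum_filter]
  refine Finset.sum_congr rfl fun p hp => ?_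
  have h5 : p.1 * p.2 = n := (Nat.mem_divisorsAntidiagonal.mp hp).1
  split_ifs with h
  · rw [← h5, hf]
    ring
  · rw [not_and_or, not_le, not_le] at h
    rcases h with h | h
    · rw [ha _ h, zero_mul, zero_mul]
    · rw [hb _ h, mul_zero, zero_mul]

/-! ## `ν ∗ υ = δ` and the support of `ς` -/

section Sigma

variable {D : ℕ} (χ : DirichletCharacter ℂ D)

/-- `χ` on `ℕ` as an arithmetic function (`toArithmeticFunction`, value `0` at `0`) agrees
with `χ` away from `0`. [folklore] -/
private lemma chiAF_apply_of_ne_zero {n : ℕ} (hn : n ≠ 0) :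
    toArithmeticFunction (fun n : ℕ => χ (n : ZMod D)) n = χ (n : ZMod D) := by
  simp [toArithmeticFunction, hn]

/-- `χ` on `ℕ` as an arithmetic function is completely multiplicative. [folklore] -/
private lemma chiAF_mul (m n : ℕ) :
    toArithmeticFunction (fun n : ℕ => χ (n : ZMod D)) (m * n) =
      toArithmeticFunction (fun n : ℕ => χ (n : ZMod D)) m *
        toArithmeticFunction (fun n : ℕ => χ (n : ZMod D)) n := by
  rcases eq_or_ne m 0 with rfl | hm
  · simp [toArithmeticFunction]
  rcases eq_or_ne n 0 with rfl | hn
  · simp [toArithmeticFunction]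
  rw [chiAF_apply_of_ne_zero χ (mul_ne_zero hm hn), chiAF_apply_of_ne_zero χ hm,
    chiAF_apply_of_ne_zero χ hn, Nat.cast_mul, map_mul]

/-- `χ(1) = 1`, as an arithmetic function. [folklore] -/
private lemma chiAF_one : toArithmeticFunction (fun n : ℕ => χ (n : ZMod D)) 1 = 1 := by
  rw [chiAF_apply_of_ne_zero χ one_ne_zero, Nat.cast_one, map_one]

/-- `ν = ζ ∗ χ` as arithmetic functions (the tree's `divisorSumChar_eq_zeta_mul`).
[cite: Zhang2022LandauSiegel, §3 p. 12 (definition of ν)] -/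
private lemma toArithmeticFunction_nu :
    toArithmeticFunction (nu χ) =
      (ζ : ArithmeticFunction ℂ) * toArithmeticFunction (fun n : ℕ => χ (n : ZMod D)) := by
  ext n
  rcases eq_or_ne n 0 with rfl | hn
  · simp [toArithmeticFunction]
  simp only [toArithmeticFunction, ArithmeticFunction.coe_mk, hn, if_false, nu]
  exact Literature.NumberTheory.LFunctions.divisorSumChar_eq_zeta_mul χ n

/-- `υ = μ ∗ μχ` as arithmetic functions. [cite: Zhang2022LandauSiegel, §3 p. 12 (definition of υ)] -/
private lemma toArithmeticFunction_ups :
    toArithmeticFunction (ups χ) =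
      (μ : ArithmeticFunction ℂ) *
        (μ : ArithmeticFunction ℂ).pmul (toArithmeticFunction (fun n : ℕ => χ (n : ZMod D))) := by
  have h1 : toArithmeticFunction (fun n : ℕ => (ArithmeticFunction.moebius n : ℂ)) =
      (μ : ArithmeticFunction ℂ) := by
    ext n
    rcases eq_or_ne n 0 with rfl | hn
    · simp [toArithmeticFunction]
    · simp [toArithmeticFunction, hn]
  have h2 : toArithmeticFunction
      (fun n : ℕ => (ArithmeticFunction.moebius n : ℂ) * χ (n : ZMod D)) =
      (μ : ArithmeticFunction ℂ).pmul (toArithmeticFunction (fun n : ℕ => χ (n : ZMod D))) := by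
    ext n
    rcases eq_or_ne n 0 with rfl | hn
    · simp [toArithmeticFunction]
    · simp [toArithmeticFunction, hn, ArithmeticFunction.pmul_apply]
  rw [ups, LSeries.convolution, ArithmeticFunction.toArithmeticFunction_eq_self, h1, h2]

/-- **`ν ∗ υ = δ`**: `(ζ∗χ)∗(μ∗μχ) = (ζ∗μ)∗(χ∗μχ) = δ∗δ` (χ completely multiplicative; the tree's
`mul_pmul_moebius_eq_one`). This is the content of "`ς(n) = 0` unless `n = 1` or `D⁴ < n ≤ D⁸`".
[cite: Zhang2022LandauSiegel, §3 p. 15] -/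
theorem nu_convolution_ups (n : ℕ) : (nu χ ⍟ ups χ) n = if n = 1 then 1 else 0 := by
  rw [LSeries.convolution, toArithmeticFunction_nu, toArithmeticFunction_ups, mul_mul_mul_comm,
    ArithmeticFunction.coe_zeta_mul_coe_moebius,
    mul_pmul_moebius_eq_one _ (chiAF_mul χ) (chiAF_one χ), one_mul,
    ArithmeticFunction.one_apply]

/-- **"`ς(n) = 0` unless `n = 1` or `D⁴ < n ≤ D⁸`"**, the part `n ≤ D⁴`, EXACT: for `n ≤ D⁴` the
truncations in `ς = (ν·1_{≤D⁴}) ∗ (υ·1_{≤D⁴})` are invisible, so `ς(n) = (ν∗υ)(n) = δ(n)`.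
[cite: Zhang2022LandauSiegel, §3 p. 15] -/
theorem sig_eq_of_le {n : ℕ} (hn : n ≤ D ^ 4) : sig χ n = if n = 1 then 1 else 0 := by
  rw [← nu_convolution_ups χ n, sig, LSeries.convolution_def, LSeries.convolution_def]
  refine Finset.sum_congr rfl fun p hp => ?_
  have h1 : p.1 ≤ n := Nat.divisor_le (Nat.fst_mem_divisors_of_mem_antidiagonal hp)
  have h2 : p.2 ≤ n := Nat.divisor_le (Nat.snd_mem_divisors_of_mem_antidiagonal hp)
  simp only [trunc, if_pos (h1.trans hn), if_pos (h2.trans hn)]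

variable [NeZero D] (x : Chr D)

/-- **"`F(s,ψ)G(s,ψ) − 1 = Σ_{D⁴<n≤D⁸} ς(n)ψ(n)n^{−s}`"** (first display of the proof of Lemma 4.2),
EXACT. [cite: Zhang2022LandauSiegel, §4 Lemma 4.2 (proof)] -/
theorem Fpoly_mul_Gpoly_sub_one (s : ℂ) :
    Fpoly χ x s * Gpoly χ x s - 1 =
      ∑ n ∈ Ioc (D ^ 4) (D ^ 8), sig χ n * x.ψ (n : ZMod x.p) * (n : ℂ) ^ (-s) := by
  set f : ℕ → ℂ := fun n => x.ψ (n : ZMod x.p) * (n : ℂ) ^ (-s) with hf_def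
  have hf : ∀ m n, f (m * n) = f m * f n := by
    intro m n
    simp only [hf_def, Nat.cast_mul, map_mul, Complex.natCast_mul_natCast_cpow]
    ring
  have hF : Fpoly χ x s = ∑ n ∈ Icc 1 (D ^ 4), trunc (D ^ 4) (nu χ) n * f n := by
    refine Finset.sum_congr rfl fun n hn => ?_
    rw [trunc, if_pos (Finset.mem_Icc.mp hn).2, hf_def, mul_assoc]
  have hG : Gpoly χ x s = ∑ n ∈ Icc 1 (D ^ 4), trunc (D ^ 4) (ups χ) n * f n := by
    refine Finset.sum_congr rfl fun n hn => ?_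
    rw [trunc, if_pos (Finset.mem_Icc.mp hn).2, hf_def, mul_assoc]
  have ht : ∀ (c : ℕ → ℂ) (n : ℕ), D ^ 4 < n → trunc (D ^ 4) c n = 0 := fun c n hn => by
    rw [trunc, if_neg (not_le.mpr hn)]
  have hD0 : 0 < D := NeZero.pos D
  have h14 : 1 ≤ D ^ 4 := Nat.one_le_pow _ _ hD0
  -- the part `n ≤ D⁴` is `ς(1)f(1) = 1`
  have hlow : ∑ n ∈ Ioc 0 (D ^ 4), sig χ n * f n = 1 := by
    rw [Finset.sum_eq_single_of_mem 1 (Finset.mem_Ioc.mpr ⟨Nat.one_pos, h14⟩)]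
    · rw [sig_eq_of_le χ h14, if_pos rfl, hf_def]
      simp
    · intro n hn hn1
      rw [sig_eq_of_le χ (Finset.mem_Ioc.mp hn).2, if_neg hn1, zero_mul]
  rw [hF, hG, sum_mul_weight_mul_sum_mul_weight _ _ f (ht _) (ht _) hf]
  have h8 : D ^ 4 * D ^ 4 = D ^ 8 := by rw [← pow_add]
  have hsig : trunc (D ^ 4) (nu χ) ⍟ trunc (D ^ 4) (ups χ) = sig χ := rfl
  have hIcc : Icc 1 (D ^ 8) = Ioc 0 (D ^ 8) := by
    rw [← Finset.Icc_add_one_left_eq_Ioc, zero_add]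
  have h48 : D ^ 4 ≤ D ^ 8 := Nat.pow_le_pow_right hD0 (by norm_num)
  rw [h8, hsig, hIcc, ← Finset.sum_Ioc_consecutive _ (Nat.zero_le (D ^ 4)) h48, hlow,
    add_sub_cancel_left]
  refine Finset.sum_congr rfl fun n _ => ?_
  simp only [hf_def, mul_assoc]

end Sigma

/-! ## Lemma 4.2 -/

/-- `⌈e³²⌉ ≤ D` gives `𝓛 = log D ≥ 32` (the threshold of the tree's `Lemma41.norm_mul_le_rpow_406`).
(Private: the general form is `Skeleton.le_ell_of_ceil_exp_le` of `Section4Lemma43Edge`.)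
[cite: Zhang2022LandauSiegel, §4 Lemma 4.1 (proof)] -/
private theorem le_ell_of_ceil_exp_le {D : ℕ} (hD : ⌈Real.exp 32⌉₊ ≤ D) : 32 ≤ ell D := by
  have h : Real.exp 32 ≤ D := le_trans (Nat.le_ceil _) (by exact_mod_cast hD)
  exact (Real.le_log_iff_exp_le (lt_of_lt_of_le (Real.exp_pos _) h)).mpr h

/-- **Lemma 4.2 HOLDS** (node `Skeleton.Lemma42` discharged, implied constant `1`, threshold
`D ≥ ⌈e³²⌉`): for `ψ ∈ Ψ₁` and `s ∈ Ω₁`, `|F(s,ψ)G(s,ψ) − 1| ≤ 𝓛⁻²²⁷`. Proof as printed: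
`FG − 1 = Σ_{D⁴<n≤D⁸} ς(n)ψ(n)n^{−s}` (`Fpoly_mul_Gpoly_sub_one`), partial integration on `Ω₁`
(`Lemma41.norm_sum_Ioc_le`: `≤ 𝓛^{4/5}|X₄(D⁸,ψ)| + 𝓛⁴⁰⁶∫_{D⁴}^{D⁸}|X₄(x,ψ)|dx/x`), and (3.6)
(`ψ ∈ Ψ₁`): `≤ 𝓛⁴⁰⁶·𝓛⁻⁶³³ = 𝓛⁻²²⁷`. [cite: Zhang2022LandauSiegel, §4 Lemma 4.2] -/
theorem lemma42_holds : Lemma42 := by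
  refine ⟨1, ⌈Real.exp 32⌉₊, fun D _ χ hD hq hp x hx s hs => ?_⟩
  have hL : 32 ≤ ell D := le_ell_of_ceil_exp_le hD
  have hL1 : 1 ≤ ell D := by linarith
  have hL0 : 0 < ell D := by linarith
  have hD1 : 1 ≤ D := NeZero.one_le
  have hDpos : (0 : ℝ) < D := by exact_mod_cast hD1
  have hD1' : (1 : ℝ) ≤ D := by exact_mod_cast hD1
  -- (3.6) for `ψ ∈ Ψ₁`
  have h36 : ‖X4 χ x ((D : ℝ) ^ 8)‖ + ∫ y in (D : ℝ) ^ 4..(D : ℝ) ^ 8, ‖X4 χ x y‖ / y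
      < (ell D ^ 633)⁻¹ := hx.2.2
  -- the normalised coefficients `c(n) = ς(n)ψ(n)n^{−s₀}` and `z = s₀ − s`
  set c : ℕ → ℂ := fun n => sig χ n * x.ψ (n : ZMod x.p) * (n : ℂ) ^ (-s0 D) with hc
  set z : ℂ := s0 D - s with hz
  have hfloor4 : ⌊(D : ℝ) ^ 4⌋₊ = D ^ 4 := by rw [← Nat.cast_pow, Nat.floor_natCast]
  have hfloor8 : ⌊(D : ℝ) ^ 8⌋₊ = D ^ 8 := by rw [← Nat.cast_pow, Nat.floor_natCast]
  -- `X_a = X₄(·,ψ)` for `a = D⁴`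
  have hX4 : Lemma41.Xsum c ((D : ℝ) ^ 4) = X4 χ x := by
    funext y
    rw [Lemma41.Xsum_eq_sum_Ioc, hfloor4, X4]
  -- `FG − 1 = Σ_{D⁴<n≤D⁸} c(n)n^{z}`
  have hsum : Fpoly χ x s * Gpoly χ x s - 1
      = ∑ n ∈ Ioc ⌊(D : ℝ) ^ 4⌋₊ ⌊(D : ℝ) ^ 8⌋₊, c n * (n : ℂ) ^ z := by
    rw [Fpoly_mul_Gpoly_sub_one, hfloor4, hfloor8]
    refine Finset.sum_congr rfl fun n hn => ?_
    have hn0 : (n : ℂ) ≠ 0 := by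
      have : 0 < n := lt_of_le_of_lt (Nat.zero_le _) (Finset.mem_Ioc.mp hn).1
      exact_mod_cast this.ne'
    rw [hc, hz, mul_assoc (sig χ n * x.ψ (n : ZMod x.p)), ← Complex.cpow_add _ _ hn0]
    congr 2
    ring
  -- the hypotheses of the partial integration on `Ω₁`
  rw [Omega1, Lemma43.mem_Omega1_iff] at hs
  obtain ⟨hs1, hs2, hs3⟩ := hs
  have hlogle : Real.log (ell D) / (100 * ell D) ≤ 1 / 100 := by
    rw [div_le_div_iff₀ (by positivity) (by norm_num)]
    have := Real.log_le_sub_one_of_pos hL0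
    linarith
  have hzre : z.re = 1 / 2 - s.re := by rw [hz, Complex.sub_re, s0_re]
  have hzim : z.im = 2 * π * t0 D - s.im := by rw [hz, Complex.sub_im, s0_im]
  have hz1 : z.re ≤ Real.log (ell D) / (100 * ell D) := by rw [hzre]; linarith
  have hz2 : |z.re| ≤ 1 := by rw [hzre, abs_le]; constructor <;> linarith
  have hz3 : |z.im| ≤ ell D ^ (405 : ℝ) + 5 := by
    rw [hzim, abs_sub_comm, Real.rpow_ofNat]
    rw [ell1] at hs3
    exact hs3.le
  have hab : (D : ℝ) ^ 4 ≤ (D : ℝ) ^ 8 := pow_le_pow_right₀ hD1' (by norm_num)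
  have ha1 : (1 : ℝ) ≤ (D : ℝ) ^ 4 := one_le_pow₀ hD1'
  have hbX : (D : ℝ) ^ 8 ≤ Real.exp (80 * ell D) := by
    rw [ell, ← Real.log_le_iff_le_exp (by positivity), Real.log_pow]
    have := Real.log_nonneg hD1'
    push_cast
    linarith
  have key := Lemma41.norm_sum_Ioc_le c hL ha1 hab hbX hz1 hz2 hz3
  rw [← hsum, hX4] at key
  -- assemble: `≤ 𝓛⁴⁰⁶ · ((3.6)) ≤ 𝓛⁴⁰⁶ · 𝓛⁻⁶³³ = 𝓛⁻²²⁷`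
  have hI0 : 0 ≤ ∫ y in (D : ℝ) ^ 4..(D : ℝ) ^ 8, ‖X4 χ x y‖ / y :=
    intervalIntegral.integral_nonneg hab fun y hy =>
      div_nonneg (norm_nonneg _) (by linarith [hy.1])
  have h45 : ell D ^ (4 / 5 : ℝ) ≤ ell D ^ (406 : ℝ) :=
    Real.rpow_le_rpow_of_exponent_le hL1 (by norm_num)
  have h406 : (0 : ℝ) < ell D ^ (406 : ℝ) := Real.rpow_pos_of_pos hL0 _
  have hpow : ell D ^ (406 : ℝ) * (ell D ^ 633)⁻¹ = 1 * (ell D ^ 227)⁻¹ := by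
    rw [Real.rpow_ofNat, one_mul, show (633 : ℕ) = 227 + 406 by norm_num, pow_add, mul_inv,
      mul_comm, mul_assoc, inv_mul_cancel₀ (pow_ne_zero _ hL0.ne'), mul_one]
  calc ‖Fpoly χ x s * Gpoly χ x s - 1‖
      ≤ ell D ^ (4 / 5 : ℝ) * ‖X4 χ x ((D : ℝ) ^ 8)‖
          + ell D ^ (406 : ℝ) * ∫ y in (D : ℝ) ^ 4..(D : ℝ) ^ 8, ‖X4 χ x y‖ / y := key
    _ ≤ ell D ^ (406 : ℝ) * ‖X4 χ x ((D : ℝ) ^ 8)‖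
          + ell D ^ (406 : ℝ) * ∫ y in (D : ℝ) ^ 4..(D : ℝ) ^ 8, ‖X4 χ x y‖ / y := by
        gcongr
    _ = ell D ^ (406 : ℝ) *
          (‖X4 χ x ((D : ℝ) ^ 8)‖ + ∫ y in (D : ℝ) ^ 4..(D : ℝ) ^ 8, ‖X4 χ x y‖ / y) := by ring
    _ ≤ ell D ^ (406 : ℝ) * (ell D ^ 633)⁻¹ := by gcongr
    _ = 1 * (ell D ^ 227)⁻¹ := hpow

end Literature.NumberTheory.LFunctions.Zhang2022.Skeleton
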